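import Summits.ResolutionOfSingularities.ResolutionOfSingularities.Theorems.FrobeniusLadderFRationalResolutionBlowupComaximalCentres
import Mathlib.RingTheory.Localization.Away.Basic
import HarnessLib

/-!
# Crux `FrobeniusLadder.FRationalResolution` (stmt-ResolutionOfSingularities-15317), line `redirect`,
# stub `stub_diagonalizableQuotientResolution` — the ORBIT CENTRE: from ONE primary piece, stable under the stabiliser of
# its point, to a centre stable under a whole finite group of ring automorphisms, with regular blow-up
# (Galois route: the remaining upstairs obligation is at ONE point over `𝔭` and its decomposition group)

Generic. `B` Noetherian, `G` a finite group acting on `B` by ring automorphisms (`act : G →* RingAut B`; for the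
Galois route `B = B₀ ⊗_K K'`, `act σ = 1 ⊗ σ`), `𝔔` maximal, `I` with `𝔔ⁿ ⊆ I ⊆ 𝔔`. HYPOTHESIS «the piece depends
only on the point»: `σ𝔔 = τ𝔔 ⇒ σI = τI` (equivalently: `I` is stable under the stabiliser of `𝔔`). Then the orbit
centre `J := ⨅_σ σI` is `G`-stable, and `Bl_J(Spec B)` is regular as soon as `Bl_{I B_g}` is regular for one `g ∉ 𝔔` and
`Spec B` is regular off the orbit of `𝔔`.

* `isRegular_affineBlowup_map_ringEquiv` — transport of `Bl_{I B_g}` regular along a ring automorphism;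
* `isRegular_affineBlowup_away_mul` — restriction from `D(g)` to `D(g h)`;
* `map_iInf_orbit_eq` — `τ J = J`;
* **`isRegular_affineBlowup_iInf_orbit`** — `Bl_J(Spec B)` is regular.

Honest label: generic plumbing (no stub closed by name); it reduces the Galois route's upstairs work to ONE point over `𝔭`:
a primary piece with regular blow-up, stable under the decomposition group — which is the comparison of chart structures
at one point (memo MEMO-15317-leafhand4-g7 §3). No definitions, no named facts, no sorry.
[cite: StacksProject, Tag 02OS; Tag 02NS; Tag 0CDQ] [cite: GortzWedhorn2020, Prop. 13.91 (2)]
-/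

noncomputable section

-- single-problem summit: the doubled namespace component is forced
set_option linter.dupNamespace false

open CategoryTheory AlgebraicGeometry TopologicalSpace
open Literature.AlgebraicGeometry.Resolution
open Summit.ResolutionOfSingularities.ResolutionOfSingularities.Theorems.FRationalResolution

namespace Summit.ResolutionOfSingularities.ResolutionOfSingularities.Theorems.FRationalResolution.BlowupOrbitCentre

/-- Transport of `Bl` regularity along a ring ISOMORPHISM of the base (an isomorphism is an open immersion).
[cite: GortzWedhorn2020, Prop. 13.91 (2)] -/
theorem isRegular_affineBlowup_map_of_ringEquiv {S T : Type} [CommRing S] [CommRing T] (e : S ≃+* T) (I : Ideal S)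
    (hreg : Scheme.IsRegular (affineBlowup I)) : Scheme.IsRegular (affineBlowup (I.map (e : S →+* T))) := by
  haveI : IsIso (CommRingCat.ofHom (e : S →+* T)) :=
    ⟨⟨CommRingCat.ofHom (e.symm : T →+* S), by ext x; simp, by ext x; simp⟩⟩
  haveI : IsOpenImmersion (Spec.map (CommRingCat.ofHom (e : S →+* T))) := inferInstance
  exact BlowupFlatCriteria.isRegular_affineBlowup_map_of_isOpenImmersion (e : S →+* T) I hreg

/-- **Transport along a ring automorphism of the base**: `Bl_{I B_g}` regular ⇒ `Bl_{(eI) B_{e g}}` regular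
(`B_g ≅ B_{e g}` over `e`). [folklore] -/
theorem isRegular_affineBlowup_map_ringEquiv {B : Type} [CommRing B] (e : B ≃+* B) (I : Ideal B) (g : B)
    (hreg : Scheme.IsRegular (affineBlowup (I.map (algebraMap B (Localization.Away g))))) :
    Scheme.IsRegular (affineBlowup ((I.map (e : B →+* B)).map (algebraMap B (Localization.Away (e g))))) := by
  have H : (Submonoid.powers g).map (e : B ≃+* B).toMonoidHom = Submonoid.powers (e g) := by
    rw [Submonoid.map_powers]; rfl
  let e' : Localization.Away g ≃+* Localization.Away (e g) :=
    IsLocalization.ringEquivOfRingEquiv (M := Submonoid.powers g) (T := Submonoid.powers (e g))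
      (Localization.Away g) (Localization.Away (e g)) e H
  have hcomp : (e' : Localization.Away g →+* Localization.Away (e g)).comp (algebraMap B (Localization.Away g)) =
      (algebraMap B (Localization.Away (e g))).comp (e : B →+* B) := by
    ext x
    simp only [RingHom.coe_comp, Function.comp_apply, RingHom.coe_coe]
    exact IsLocalization.ringEquivOfRingEquiv_eq H x
  have := isRegular_affineBlowup_map_of_ringEquiv e' _ hreg
  rw [Ideal.map_map, hcomp, ← Ideal.map_map] at this
  exact this

/-- **Restriction from `D(g)` to `D(g h)`**: `Bl_{I B_g}` regular ⇒ `Bl_{I B_{g h}}` regular (`B_{g h}` is a localization of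
`B_g`, an open piece). [cite: GortzWedhorn2020, Prop. 13.91 (2)] -/
theorem isRegular_affineBlowup_away_mul {B : Type} [CommRing B] (I : Ideal B) (g h : B)
    (hreg : Scheme.IsRegular (affineBlowup (I.map (algebraMap B (Localization.Away g))))) :
    Scheme.IsRegular (affineBlowup (I.map (algebraMap B (Localization.Away (g * h))))) := by
  set S := Localization.Away g with hS
  set T := Localization.Away (algebraMap B S h) with hT
  -- `T` is a localization of `B` away from `g * h`
  haveI : IsLocalization.Away (g * h) T := inferInstance
  haveI : IsOpenImmersion (Spec.map (CommRingCat.ofHom (algebraMap S T))) :=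
    IsOpenImmersion.of_isLocalization (algebraMap B S h)
  have h1 : Scheme.IsRegular (affineBlowup ((I.map (algebraMap B S)).map (algebraMap S T))) :=
    BlowupFlatCriteria.isRegular_affineBlowup_map_of_isOpenImmersion (algebraMap S T) _ hreg
  rw [Ideal.map_map, ← IsScalarTower.algebraMap_eq B S T] at h1
  -- compare `T` with the standard model `B_{g h}`
  let e' : T ≃+* Localization.Away (g * h) :=
    (IsLocalization.algEquiv (Submonoid.powers (g * h)) T (Localization.Away (g * h))).toRingEquiv
  have hcomp : (e' : T →+* Localization.Away (g * h)).comp (algebraMap B T) =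
      algebraMap B (Localization.Away (g * h)) := by
    ext x
    simp only [RingHom.coe_comp, Function.comp_apply, RingHom.coe_coe]
    exact IsLocalization.algEquiv_apply (Submonoid.powers (g * h)) T (Localization.Away (g * h)) _ ▸
      (IsLocalization.algEquiv (Submonoid.powers (g * h)) T (Localization.Away (g * h))).commutes x
  have := isRegular_affineBlowup_map_of_ringEquiv e' _ h1
  rw [Ideal.map_map, hcomp] at this
  exact this

/-- Composition of twists: `τ (ρ I) = (τ ρ) I`. [folklore] -/
theorem map_map_act {B : Type} [CommRing B] {G : Type} [Group G] (act : G →* RingAut B) (I : Ideal B) (τ ρ : G) :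
    (I.map (act ρ : B →+* B)).map (act τ : B →+* B) = I.map (act (τ * ρ) : B →+* B) := by
  rw [Ideal.map_map, map_mul]
  rfl

/-- **The orbit centre is stable**: for `act : G →* RingAut B` and any ideal `I`,
`τ (⨅_σ σ I) = ⨅_σ σ I`. [folklore] -/
theorem map_iInf_orbit_eq {B : Type} [CommRing B] {G : Type} [Group G] (act : G →* RingAut B)
    (I : Ideal B) (τ : G) :
    (⨅ σ, I.map (act σ : B →+* B)).map (act τ : B →+* B) = ⨅ σ, I.map (act σ : B →+* B) := by
  apply le_antisymm
  · refine le_iInf fun σ => ?_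
    calc (⨅ ρ, I.map (act ρ : B →+* B)).map (act τ : B →+* B)
        ≤ (I.map (act (τ⁻¹ * σ) : B →+* B)).map (act τ : B →+* B) := Ideal.map_mono (iInf_le _ (τ⁻¹ * σ))
      _ = I.map (act σ : B →+* B) := by rw [map_map_act, mul_inv_cancel_left]
  · intro x hx
    have hx' : (act τ).symm x ∈ ⨅ σ, I.map (act σ : B →+* B) := by
      refine (Ideal.mem_iInf).mpr fun σ => ?_
      have h1 : x ∈ I.map (act (τ * σ) : B →+* B) := (Ideal.mem_iInf.mp hx) (τ * σ)
      rw [← map_map_act, Ideal.map_comap_of_equiv (I := I.map (act σ : B →+* B))] at h1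
      exact Ideal.mem_comap.mp h1
    have hx'' := Ideal.mem_map_of_mem (act τ : B →+* B) hx'
    simpa using hx''

/-- **THE ORBIT CENTRE HAS REGULAR BLOW-UP.** `B` Noetherian with a finite group `G` of ring automorphisms, `𝔔` maximal,
`𝔔ⁿ ⊆ I ⊆ 𝔔`, the piece depending only on the point (`σ𝔔 = τ𝔔 ⇒ σI = τI`, i.e. `I` is stable under the stabiliser of
`𝔔`), `Spec B` regular at every prime outside the orbit of `𝔔`, and `Bl_{I B_g}` regular for some `g ∉ 𝔔`. Then the
blow-up of `Spec B` along the `G`-stable orbit centre `⨅_σ σI` is regular. [cite: StacksProject, Tag 02OS; Tag 02NS]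
[cite: GortzWedhorn2020, Prop. 13.91 (2)] -/
theorem isRegular_affineBlowup_iInf_orbit {B : Type} [CommRing B] [IsNoetherianRing B] {G : Type} [Group G]
    [Fintype G] (act : G →* RingAut B) (𝔔 : Ideal B) [h𝔔 : 𝔔.IsMaximal] (I : Ideal B) {n : ℕ} (hpI : 𝔔 ^ n ≤ I)
    (hIp : I ≤ 𝔔)
    (hpt : ∀ σ τ : G, 𝔔.map (act σ : B →+* B) = 𝔔.map (act τ : B →+* B) →
      I.map (act σ : B →+* B) = I.map (act τ : B →+* B))
    (hoff : ∀ x : Spec (.of B), (∀ σ : G, x.asIdeal ≠ 𝔔.map (act σ : B →+* B)) →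
      x ∈ Scheme.regularLocus (Spec (.of B)))
    (hreg : ∃ g : B, g ∉ 𝔔 ∧ Scheme.IsRegular (affineBlowup (I.map (algebraMap B (Localization.Away g))))) :
    Scheme.IsRegular (affineBlowup (⨅ σ, I.map (act σ : B →+* B))) := by
  classical
  set J := ⨅ σ, I.map (act σ : B →+* B) with hJ
  -- the orbit points are maximal ideals
  have hmax : ∀ σ : G, (𝔔.map (act σ : B →+* B)).IsMaximal := fun σ => by
    rw [Ideal.map_comap_of_equiv]
    exact Ideal.comap_isMaximal_of_surjective _ (act σ).symm.surjective
  -- a maximal ideal containing `τ I` is the orbit point `τ 𝔔`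
  have horb : ∀ (τ : G) (𝔪 : Ideal B) [𝔪.IsMaximal], I.map (act τ : B →+* B) ≤ 𝔪 →
      𝔔.map (act τ : B →+* B) = 𝔪 := by
    intro τ 𝔪 h𝔪 hτ
    have hpow : (𝔔.map (act τ : B →+* B)) ^ n ≤ 𝔪 := by
      rw [← Ideal.map_pow]; exact (Ideal.map_mono hpI).trans hτ
    exact (hmax τ).eq_of_le h𝔪.ne_top (Ideal.IsPrime.le_of_pow_le hpow)
  refine BlowupComaximalCentres.isRegular_affineBlowup_of_forall_maximal_le J
    (fun x hx => hoff x fun σ hxσ => hx ?_) ?_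
  · rw [hxσ]; exact (iInf_le _ σ).trans (Ideal.map_mono hIp)
  · intro 𝔪 h𝔪 hJ𝔪
    -- `𝔪 = σ 𝔔` for some `σ`
    have hinf : (Finset.univ.inf fun σ : G => I.map (act σ : B →+* B)) ≤ 𝔪 := by
      refine le_trans (le_of_eq ?_) hJ𝔪
      rw [hJ, Finset.inf_eq_iInf]; simp
    obtain ⟨σ, -, hσ⟩ := (Ideal.IsPrime.inf_le' h𝔪.isPrime).mp hinf
    have h𝔔𝔪 : 𝔔.map (act σ : B →+* B) = 𝔪 := horb σ 𝔪 hσ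
    obtain ⟨g₀, hg₀, hreg₀⟩ := hreg
    -- an element of every piece at the OTHER orbit points, outside `𝔪`
    set S : Finset G := Finset.univ.filter fun τ => 𝔔.map (act τ : B →+* B) ≠ 𝔪 with hS
    have hne : ¬ (S.inf fun τ => I.map (act τ : B →+* B)) ≤ 𝔪 := by
      intro hle
      obtain ⟨τ, hτS, hτ⟩ := (Ideal.IsPrime.inf_le' h𝔪.isPrime).mp hle
      exact (Finset.mem_filter.mp hτS).2 (horb τ 𝔪 hτ)
    obtain ⟨h, hhS, hh𝔪⟩ := SetLike.not_le_iff_exists.mp hne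
    have hσg₀ : (act σ) g₀ ∉ 𝔪 := by
      rw [← h𝔔𝔪, Ideal.map_comap_of_equiv, Ideal.mem_comap]
      simpa using hg₀
    set g : B := (act σ) g₀ * h with hg
    have hg𝔪 : g ∉ 𝔪 := fun hmem => (h𝔪.isPrime.mem_or_mem hmem).elim hσg₀ hh𝔪
    refine ⟨g, hg𝔪, ?_⟩
    -- near `𝔪` the orbit centre IS the piece `σ I`
    have hJloc : J.map (algebraMap B (Localization.Away g)) =
        (I.map (act σ : B →+* B)).map (algebraMap B (Localization.Away g)) := by
      refine le_antisymm (Ideal.map_mono (iInf_le _ σ)) ?_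
      rw [Ideal.map_le_iff_le_comap]
      intro x hx
      rw [Ideal.mem_comap]
      have hxh : x * h ∈ J := by
        refine Ideal.mem_iInf.mpr fun τ => ?_
        by_cases hτ : 𝔔.map (act τ : B →+* B) = 𝔪
        · rw [hpt τ σ (hτ.trans h𝔔𝔪.symm)]
          exact Ideal.mul_mem_right _ _ hx
        · have hτS : τ ∈ S := Finset.mem_filter.mpr ⟨Finset.mem_univ _, hτ⟩
          exact Ideal.mul_mem_left _ _ ((Finset.inf_le hτS : (S.inf fun τ => I.map (act τ : B →+* B)) ≤ _) hhS)
      have hunit : IsUnit (algebraMap B (Localization.Away g) h) := by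
        have hu : IsUnit (algebraMap B (Localization.Away g) g) := IsLocalization.Away.algebraMap_isUnit g
        rw [hg, map_mul] at hu
        exact isUnit_of_mul_isUnit_right hu
      obtain ⟨u, hu⟩ := hunit
      have hx' : algebraMap B (Localization.Away g) x =
          algebraMap B (Localization.Away g) (x * h) * ↑u⁻¹ := by
        rw [map_mul, ← hu, mul_assoc, Units.mul_inv, mul_one]
      rw [hx']
      exact Ideal.mul_mem_right _ _ (Ideal.mem_map_of_mem _ hxh)
    rw [hJloc, hg]
    exact isRegular_affineBlowup_away_mul _ _ h (isRegular_affineBlowup_map_ringEquiv (act σ) I g₀ hreg₀)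

end Summit.ResolutionOfSingularities.ResolutionOfSingularities.Theorems.FRationalResolution.BlowupOrbitCentre

end
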